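import Summits.QuantumAdvantage.AdviceFreeQNC0.AffBells22Geo
import HarnessLib

/-!
# Cell qa-qnc0, the GEOMETRIC MODEL of plan S2 (ROUND-21 §1b): SPAN-Φ, the FRAME EXPANSION — planner qa-qnc0-p1 g22,
`Sketch22.lean` §1b, statements VERBATIM

Support for crux `RingDenseResidualLt3` (stmt-QuantumAdvantage-22907), route `DWalkThree`, rung candidate
`RingFrameAffineLt3`.  Objects VERBATIM from the planner's `exp22/Sketch22.lean`: `frameRows` (`B = M·V + E`), `shiftRes`
(`ρ_k − ⟨E_k, F⟩`), `wtOffT` (weight of `tV` off the junta `T`), `SpanPhiBound`.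

PROVED here (0 sorry): **`spanPhiBound : SpanPhiBound`** — for a perturbation `E` supported on `T`,
`|bias(MV+E, ρ, 0)| ≤ (Σ_F |geoBiasNum(M, ρ − E·F)|)/(2^q 3^m) + Σ_{t ≠ 0} 2^{−wt_{T^c}(tV)}`.
Proof: the hit count of the frame system at `F` is the geometric hit count at the frame point `u(F) = V·F` with residues
shifted by `⟨E_k,F⟩` (`card_hits_frame`); expand `w ↦ (−1)^{hits(w)}` in the characters of `𝔽₃^m`
(`fourier_inversion`, orthogonality `TwoModuli.sum_stdAddChar_dot_eq_ite`), substitute `w = u(F)`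
(`TwoModuli.sum_mul_linForms_eq`); the `t = 0` coefficient is `3^{−m}·geoBiasNum`, and for `t ≠ 0` the coefficient only
reads `F|_T` (`shiftRes_eq_of_agree`) and has modulus `≤ 1` (`norm_fhat_le`), so the off-junta decay
`AffBells21.norm_sum_mul_stdAddChar_le_of_junta` ([ChattopadhyayWigderson2009] separation of variables, `cos(π/3) = 1/2`)
gives the factor `2^{−wt_{T^c}(tV)}`.

WHAT THIS IS NOT: the CLASS version (with the `(√3/2)^Z` parity-class term) needed by the frame plan is not stated by the
planner yet; nothing here touches the crux.
-/

namespace Summit.QuantumAdvantage.AdviceFreeQNC0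

open Finset
open Literature.Computability.MetaComplexity

namespace AffBells22

/-! ## §1b statements (planner qa-qnc0-p1 g22, Sketch22.lean §1b — VERBATIM) -/

/-- Rows in a frame: `B_k = M_k·V + E_k`. -/
def frameRows {q m s : ℕ} (M : Fin s → Fin m → ZMod 3) (V : Fin m → Fin q → ZMod 3) (E : Fin s → Fin q → ZMod 3) :
    Fin s → Fin q → ZMod 3 :=
  fun k j => (∑ i : Fin m, M k i * V i j) + E k j

/-- Residues shifted by the perturbation's value at `F`: `ρ_k − ⟨E_k, F⟩`. -/
def shiftRes {q s : ℕ} (ρ : Fin s → ZMod 3) (E : Fin s → Fin q → ZMod 3) (F : Fin q → Bool) : Fin s → ZMod 3 :=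
  fun k => ρ k - ∑ j : Fin q, (if F j then E k j else 0)

/-- Weight of the frame combination `tV` OFF the junta `T`. -/
def wtOffT {q m : ℕ} (V : Fin m → Fin q → ZMod 3) (T : Finset (Fin q)) (t : Fin m → ZMod 3) : ℕ :=
  ((univ \ T).filter fun j : Fin q => (∑ i : Fin m, t i * V i j) ≠ 0).card

/-- **SPAN-Φ, the FRAME EXPANSION** (support; expand `u ↦ (−1)^{hits(u, F_T)}` in the characters of `𝔽₃^m`, substitute
`u = V·F`, bound `|E_F ĥ(t,F_T) ω^{⟨tV,F⟩}| ≤ ‖ĥ_t‖_∞ · 2^{−wt_{T^c}(tV)}` by the off-junta decay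
`AffBells21.norm_sum_mul_stdAddChar_le_of_junta`; the `t = 0` term is the average over `F_T` of the geometric bias with
shifted residues):  for `E` supported on `T`,
`|bias(MV+E, ρ, 0)| ≤ E_F |geobias(M, ρ − E·F)| + Σ_{t ≠ 0} 2^{−wt_{T^c}(tV)}`.
BLOCK-Φ (`AffBells21.BlockPhiBound`) is the case "`M` = cluster incidence"; (PHI) is `M = 1` with the sharp `|ĥ|`.
Kit j300029 part D: 120/120; part A1 (`q = 22`, pools): `|bias − geobias| ≤ .0014`. -/
def SpanPhiBound : Prop :=
  ∀ (q m s : ℕ) (M : Fin s → Fin m → ZMod 3) (V : Fin m → Fin q → ZMod 3) (E : Fin s → Fin q → ZMod 3)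
    (T : Finset (Fin q)) (ρ : Fin s → ZMod 3), (∀ k j, j ∉ T → E k j = 0) →
    |AffBells21.bias q s (frameRows M V E) ρ (fun _ => false)|
      ≤ (∑ F : Fin q → Bool, |(geoBiasNum m s M (shiftRes ρ E F) : ℝ)|) / ((2 : ℝ) ^ q * (3 : ℝ) ^ m)
        + ∑ t ∈ (univ : Finset (Fin m → ZMod 3)).erase 0, ((2 : ℝ)⁻¹) ^ wtOffT V T t

/-! ## Fourier inversion on `𝔽₃^m` -/

variable {q m s : ℕ}

/-- The Fourier coefficient `ĝ(t) = 3^{−m} Σ_v g(v) ω^{−⟨t,v⟩}` of a function on `𝔽₃^m`. -/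
noncomputable def fhat (m : ℕ) (g : (Fin m → ZMod 3) → ℂ) (t : Fin m → ZMod 3) : ℂ :=
  ((3 : ℂ) ^ m)⁻¹ * ∑ v : Fin m → ZMod 3, g v * (ZMod.stdAddChar (-(∑ i : Fin m, t i * v i)) : ℂ)

/-- Fourier inversion on `𝔽₃^m`: `g(w) = Σ_t ĝ(t) ω^{⟨t,w⟩}`. -/
theorem fourier_inversion (g : (Fin m → ZMod 3) → ℂ) (w : Fin m → ZMod 3) :
    g w = ∑ t : Fin m → ZMod 3, fhat m g t * (ZMod.stdAddChar (∑ i : Fin m, t i * w i) : ℂ) := by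
  unfold fhat
  have h3 : ((3 : ℂ) ^ m) ≠ 0 := pow_ne_zero _ (by norm_num)
  have h1 : ∀ t : Fin m → ZMod 3,
      ((3 : ℂ) ^ m)⁻¹ * (∑ v : Fin m → ZMod 3, g v * (ZMod.stdAddChar (-(∑ i : Fin m, t i * v i)) : ℂ))
        * (ZMod.stdAddChar (∑ i : Fin m, t i * w i) : ℂ)
        = ((3 : ℂ) ^ m)⁻¹ * ∑ v : Fin m → ZMod 3, g v * (ZMod.stdAddChar (∑ i : Fin m, t i * (w - v) i) : ℂ) := by
    intro t
    rw [mul_assoc, sum_mul]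
    congr 1
    refine sum_congr rfl fun v _ => ?_
    rw [mul_assoc, ← AddChar.map_add_eq_mul]
    congr 2
    rw [← sum_neg_distrib, ← sum_add_distrib]
    exact sum_congr rfl fun i _ => by rw [Pi.sub_apply]; ring
  simp_rw [h1]
  rw [← mul_sum, sum_comm]
  simp_rw [← mul_sum]
  have h2 : ∀ v : Fin m → ZMod 3, ∑ t : Fin m → ZMod 3, (ZMod.stdAddChar (∑ i : Fin m, t i * (w - v) i) : ℂ)
      = if w = v then (3 : ℂ) ^ m else 0 := by
    intro v
    rw [TwoModuli.sum_stdAddChar_dot_eq_ite (w - v)]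
    by_cases hwv : w = v
    · rw [if_pos (sub_eq_zero.mpr hwv), if_pos hwv]
      push_cast
      rfl
    · rw [if_neg (fun h => hwv (sub_eq_zero.mp h)), if_neg hwv]
  simp_rw [h2, mul_ite, mul_zero]
  rw [Finset.sum_ite_eq univ w]
  simp only [mem_univ, if_true]
  rw [mul_comm (g w), ← mul_assoc, inv_mul_cancel₀ h3, one_mul]

/-- A Fourier coefficient of a `±1`-valued (more generally unimodular-bounded) function has modulus `≤ 1`. -/
theorem norm_fhat_le (g : (Fin m → ZMod 3) → ℂ) (hg : ∀ v, ‖g v‖ ≤ 1) (t : Fin m → ZMod 3) : ‖fhat m g t‖ ≤ 1 := by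
  unfold fhat
  rw [norm_mul, norm_inv, norm_pow]
  have h3 : ‖(3 : ℂ)‖ = 3 := by simp
  rw [h3]
  have hsum : ‖∑ v : Fin m → ZMod 3, g v * (ZMod.stdAddChar (-(∑ i : Fin m, t i * v i)) : ℂ)‖ ≤ (3 : ℝ) ^ m := by
    refine (norm_sum_le _ _).trans ?_
    calc ∑ v : Fin m → ZMod 3, ‖g v * (ZMod.stdAddChar (-(∑ i : Fin m, t i * v i)) : ℂ)‖
        ≤ ∑ v : Fin m → ZMod 3, (1 : ℝ) := sum_le_sum fun v _ => by
          rw [norm_mul, AffBells21.norm_stdAddChar_three, mul_one]; exact hg v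
      _ = (3 : ℝ) ^ m := by
          rw [sum_const, card_univ, Fintype.card_fun, ZMod.card, Fintype.card_fin]; simp
  have hpos : (0 : ℝ) < (3 : ℝ) ^ m := by positivity
  calc ((3 : ℝ) ^ m)⁻¹ * ‖∑ v : Fin m → ZMod 3, g v * (ZMod.stdAddChar (-(∑ i : Fin m, t i * v i)) : ℂ)‖
      ≤ ((3 : ℝ) ^ m)⁻¹ * (3 : ℝ) ^ m := mul_le_mul_of_nonneg_left hsum (by positivity)
    _ = 1 := inv_mul_cancel₀ hpos.ne'

/-! ## The frame expansion -/

/-- The frame coordinates of a coin vector: `u(F)_i = Σ_j [F_j] V_{ij}`. -/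
def frameU (V : Fin m → Fin q → ZMod 3) (F : Fin q → Bool) : Fin m → ZMod 3 :=
  fun i => ∑ j : Fin q, if F j then V i j else 0

/-- Hits of the frame system at `F` = geometric hits at `u(F)` with shifted residues. -/
theorem card_hits_frame (M : Fin s → Fin m → ZMod 3) (V : Fin m → Fin q → ZMod 3) (E : Fin s → Fin q → ZMod 3)
    (ρ : Fin s → ZMod 3) (F : Fin q → Bool) :
    (univ.filter fun k : Fin s => AffBells21.rowSum (frameRows M V E) k F = ρ k).card
      = geoHits m s M (shiftRes ρ E F) (frameU V F) := by
  unfold geoHits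
  congr 1
  refine filter_congr fun k _ => ?_
  have hrow : AffBells21.rowSum (frameRows M V E) k F
      = (∑ i : Fin m, M k i * frameU V F i) + ∑ j : Fin q, (if F j then E k j else 0) := by
    unfold AffBells21.rowSum frameRows frameU
    rw [TwoModuli.sum_mul_linForms_eq, ← sum_add_distrib]
    refine sum_congr rfl fun j _ => ?_
    by_cases hF : F j <;> simp [hF]
  rw [hrow]
  unfold shiftRes
  constructor
  · intro h; rw [← h]; ring
  · intro h; rw [h]; ring

/-- The shifted residues only read the junta `T` carrying the perturbation. -/
theorem shiftRes_eq_of_agree (ρ : Fin s → ZMod 3) (E : Fin s → Fin q → ZMod 3) (T : Finset (Fin q))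
    (hE : ∀ k j, j ∉ T → E k j = 0) {F F' : Fin q → Bool} (hFF' : ∀ j ∈ T, F j = F' j) :
    shiftRes ρ E F = shiftRes ρ E F' := by
  funext k
  unfold shiftRes
  congr 1
  refine sum_congr rfl fun j _ => ?_
  by_cases hj : j ∈ T
  · rw [hFF' j hj]
  · rw [hE k j hj]; simp

/-- **SPAN-Φ, PROVED.** -/
theorem spanPhiBound : SpanPhiBound := by
  intro q m s M V E T ρ hE
  -- the signed count `S` with `bias = S / 2^q`
  have hempty : ∀ F : Fin q → Bool,
      (univ.filter fun j : Fin q => (fun _ : Fin q => false) j = true ∧ F j = true).card = 0 := by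
    intro F
    rw [Finset.card_eq_zero, Finset.filter_eq_empty_iff]
    intro j _ h
    exact Bool.false_ne_true h.1
  set g : (Fin q → Bool) → (Fin m → ZMod 3) → ℂ := fun F w => (-1 : ℂ) ^ geoHits m s M (shiftRes ρ E F) w with hgdef
  set S : ℝ := ∑ F : Fin q → Bool, (-1 : ℝ) ^ geoHits m s M (shiftRes ρ E F) (frameU V F) with hSdef
  have hbias : AffBells21.bias q s (frameRows M V E) ρ (fun _ => false) = S / (2 : ℝ) ^ q := by
    rw [AffBells21.bias_eq_sum_rowSum, hSdef]
    congr 1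
    refine sum_congr rfl fun F _ => ?_
    rw [hempty F, add_zero, card_hits_frame]
  -- expand each sign in the characters of 𝔽₃^m and substitute u = V·F
  have hS : (S : ℂ) = ∑ t : Fin m → ZMod 3, ∑ F : Fin q → Bool,
      fhat m (g F) t * (ZMod.stdAddChar (∑ j : Fin q, if F j then (∑ i : Fin m, t i * V i j) else 0) : ℂ) := by
    rw [hSdef, Complex.ofReal_sum, sum_comm]
    refine sum_congr rfl fun F _ => ?_
    rw [Complex.ofReal_pow, Complex.ofReal_neg, Complex.ofReal_one]
    have h := fourier_inversion (g F) (frameU V F)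
    simp only [hgdef] at h ⊢
    rw [h]
    refine sum_congr rfl fun t _ => ?_
    congr 2
    unfold frameU
    exact TwoModuli.sum_mul_linForms_eq t V F
  -- the coefficients only read `T` and are bounded by 1
  have hg1 : ∀ F w, ‖g F w‖ ≤ 1 := by
    intro F w
    simp only [hgdef, norm_pow, norm_neg, norm_one, one_pow, le_refl]
  have hagree : ∀ (t : Fin m → ZMod 3) (F F' : Fin q → Bool), (∀ j ∈ T, F j = F' j) →
      fhat m (g F) t = fhat m (g F') t := by
    intro t F F' hFF'
    simp only [hgdef]
    rw [shiftRes_eq_of_agree ρ E T hE hFF']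
  -- the `t = 0` term
  have h0 : ∑ F : Fin q → Bool, fhat m (g F) 0 * (ZMod.stdAddChar (∑ j : Fin q, if F j then (∑ i : Fin m, (0 : Fin m → ZMod 3) i * V i j) else 0) : ℂ)
      = ((3 : ℂ) ^ m)⁻¹ * ∑ F : Fin q → Bool, ((geoBiasNum m s M (shiftRes ρ E F) : ℤ) : ℂ) := by
    rw [mul_sum]
    refine sum_congr rfl fun F _ => ?_
    have hz : (∑ j : Fin q, if F j then (∑ i : Fin m, (0 : Fin m → ZMod 3) i * V i j) else 0) = 0 := by
      refine sum_eq_zero fun j _ => ?_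
      split_ifs <;> simp
    rw [hz, AddChar.map_zero_eq_one, mul_one]
    unfold fhat geoBiasNum
    simp only [hgdef, Pi.zero_apply, zero_mul, sum_const_zero, neg_zero, AddChar.map_zero_eq_one, mul_one]
    push_cast
    rfl
  -- norm of the `t = 0` term
  have hn0 : ‖((3 : ℂ) ^ m)⁻¹ * ∑ F : Fin q → Bool, ((geoBiasNum m s M (shiftRes ρ E F) : ℤ) : ℂ)‖
      ≤ (∑ F : Fin q → Bool, |(geoBiasNum m s M (shiftRes ρ E F) : ℝ)|) / (3 : ℝ) ^ m := by
    rw [norm_mul, norm_inv, norm_pow, show ‖(3 : ℂ)‖ = 3 by simp, div_eq_inv_mul]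
    refine mul_le_mul_of_nonneg_left ?_ (by positivity)
    refine (norm_sum_le _ _).trans (le_of_eq (sum_congr rfl fun F _ => ?_))
    rw [show ((geoBiasNum m s M (shiftRes ρ E F) : ℤ) : ℂ) = (((geoBiasNum m s M (shiftRes ρ E F) : ℤ) : ℝ) : ℂ) by
      norm_cast, Complex.norm_real, Real.norm_eq_abs]
  -- norm of the `t ≠ 0` terms
  have hnt : ∀ t : Fin m → ZMod 3,
      ‖∑ F : Fin q → Bool, fhat m (g F) t
          * (ZMod.stdAddChar (∑ j : Fin q, if F j then (∑ i : Fin m, t i * V i j) else 0) : ℂ)‖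
        ≤ (2 : ℝ) ^ q * (2 : ℝ)⁻¹ ^ wtOffT V T t := by
    intro t
    refine (AffBells21.norm_sum_mul_stdAddChar_le_of_junta T (fun F => fhat m (g F) t) (hagree t)
      (fun j => ∑ i : Fin m, t i * V i j)).trans ?_
    have hcard : (univ.filter fun j : Fin q => j ∉ T ∧ (∑ i : Fin m, t i * V i j) ≠ 0).card = wtOffT V T t := by
      unfold wtOffT
      rw [Finset.sdiff_eq_filter, Finset.filter_filter]
    rw [hcard, mul_comm]
    refine mul_le_mul_of_nonneg_right ?_ (by positivity)
    calc ∑ F : Fin q → Bool, ‖fhat m (g F) t‖ ≤ ∑ F : Fin q → Bool, (1 : ℝ) :=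
          sum_le_sum fun F _ => norm_fhat_le (g F) (hg1 F) t
      _ = (2 : ℝ) ^ q := by
          rw [sum_const, card_univ, Fintype.card_fun, Fintype.card_bool, Fintype.card_fin]; simp
  -- assemble
  have hSabs : |S| ≤ (∑ F : Fin q → Bool, |(geoBiasNum m s M (shiftRes ρ E F) : ℝ)|) / (3 : ℝ) ^ m
      + (2 : ℝ) ^ q * ∑ t ∈ (univ : Finset (Fin m → ZMod 3)).erase 0, ((2 : ℝ)⁻¹) ^ wtOffT V T t := by
    rw [← Real.norm_eq_abs, ← Complex.norm_real, hS, ← Finset.add_sum_erase univ _ (mem_univ (0 : Fin m → ZMod 3)),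
      h0]
    refine (norm_add_le _ _).trans (add_le_add hn0 ?_)
    refine (norm_sum_le _ _).trans ?_
    rw [mul_sum]
    exact sum_le_sum fun t _ => hnt t
  rw [hbias, abs_div, abs_of_pos (by positivity : (0 : ℝ) < 2 ^ q), div_le_iff₀ (by positivity)]
  refine hSabs.trans (le_of_eq ?_)
  have h2 : (0 : ℝ) < (2 : ℝ) ^ q := by positivity
  have h3 : (0 : ℝ) < (3 : ℝ) ^ m := by positivity
  field_simp

end AffBells22

end Summit.QuantumAdvantage.AdviceFreeQNC0
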